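import Summits.QuantumFields.YangMills.Theorems.BalabanUVNodesN19TVCommonStepContraction
import Mathlib.Probability.Kernel.Composition.ParallelComp
import Summits.QuantumFields.YangMills.Theorems.BalabanUVNodesN14SharpTiltDefect

/-!
# BalabanUVNodes ∕ N19 — THE TV CURRENCY's COMMON-STEP CONTRACTION AT THE CLASS LEVEL: class pieces pushed through a COMMON Markov step with row coefficient `α` keep their
# MASS_cl letter VERBATIM and see their TV_cl radius MULTIPLIED by `α` (plus the fibre injection `σ` of a two-run step); hence `Spine.NE7.Core` for the image datum with width
# `r + (e^{2l₀B} − 1)(αρ + σ)`, and the N19′ shape `∃ δ, Core … δ ∧ Summable δ` when an `O(1)` class-law birth is followed by `K` common contracting steps (`α_K ≤ a^K`)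

Cell `pub-ymgap` (HUMAN RULING D-0062 Track A ∕ D-0149 width seats), WIDTH SEAT `pub-ymgap-dag-n19-w2` (node n19 = NE7, seat 2 of 3), generation g8, CLAIM-3 ∕ INTENT-3.
Route `Summits/QuantumFields/YangMills/Theses/BalabanUVNodes.lean`, key item K3⁸ `SpineGivenEndpointR13SepCoPHV` (stmt-QuantumFields-27366); filed `--kind proof --supports …
--as helper`.  COUNT-NEUTRAL.  THEOREMS ONLY (0 `def`, 0 `sorry`); imports this seat's g8 file 1 `…N19TVCommonStepContraction` (Dobrushin's kernel-level contraction
`abs_comp_real_sub_comp_real_le_mul_of_tv` ∕ `…_le_mul_add_of_tv`, and through it g4's `…N19TVProductBlocks` normalisation dictionary `normalized_real` ∕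
`isProbabilityMeasure_normalized` ∕ `div_univ_eq_zero_of_mass`, dag-n19-c's `…N19CoreTVInvariant.core_of_mass_of_tv`) and Mathlib's `Measure.comp_smul` ∕ `Measure.comp_apply_univ`
`Kernel.parallelComp`, and dag-n14-w3's `…N14SharpTiltDefect` (`YMDAG.N14.SharpTilt.abs_measureReal_tilted_sub_le_tanh`, the sharp tilt-defect constant) — all CONSUMED BY
NAME; edits nothing, re-declares nothing.

WHY.  File 1 typed Dobrushin's contraction for ONE class (probability laws).  Node U5's data are CLASS PIECES — finite measures `μA K τ`, `μB K τ` indexed by the large-field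
classes, read in dag-n19-c's normalised TV_cl letters `|μB(S)∕μB(univ) − μA(S)∕μA(univ)| ≤ ρ K` and the MASS_cl sandwich `e^{c−r}·μA(univ) ≤ μB(univ) ≤ e^{c+r}·μA(univ)` — and
g4 carried the TV calculus to that level for independent blocks (file 2 `…N19CoreTVInvariantBlocks`), disintegrations (file 5 `…N19CoreTVInvariantDisintegration`, where a COMMON
conditional kernel is free) and — deferred in g4's HANDOFF (t7) — NOT for the image under a common Markov step.  This file is that edition, with the contraction: the image pieces
`κ K τ ∘ₘ μA K τ`, `κB K τ ∘ₘ μB K τ` (i) have the SAME masses (`Measure.comp_apply_univ`), so the MASS_cl letter passes verbatim with its constants and radius; (ii) have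
normalised laws = images of the normalised laws (`normalized_comp`), so file 1 gives TV_cl(`α K·ρ K + σ K`) when run A's step has rows `α K`-close and run B's step is fibrewise
`σ K`-close to it (massless classes are massless together under any MASS_cl sandwich, `mass_zero_iff_of_sandwich`); (iii) hence, by dag-n19-c's necessary-and-sufficient invariant,
`Spine.NE7.Core` for the dressed image class terms with width `r K + (e^{2l₀B} − 1)(α K·ρ K + σ K)`, and the N19′ shape as soon as these widths are summable — in particular for
EXACTLY common steps whose coefficient at run pair `K` is `≤ a^K` (file 1 §3: `K` steps each of coefficient `≤ a` compose to `≤ a^K`) acting on an `O(1)` TV_cl birth discrepancy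
(`ρ K ≤ 1`, free) with a summable MASS radius.  In g6's log-ratio currency the analogous statement (`…N19CoreCommonStep` §4) needs a finite projective diameter per step and leaves a
rigid SOURCE half (`…N19CoreCommonStepFloor`); here the TV letter is per `K` (source-free) and the MASS half is untouched — the source dependence lives entirely in the MGF dressing.

WHAT IS PROVED ([folklore] measure theory on hypothesis SHAPES).
* §1 ONE PIECE: `normalized_comp` · `comp_div_eq_normalized_comp_real` · ★★ `abs_comp_div_sub_le_mul_of_tv` (finite pieces massless together, TV_cl(`ρ`), ONE common Markov kernel
  with rows `α`-close, `0 ≤ α` ⇒ image pieces TV_cl(`α·ρ`)) · ★ `abs_comp_div_sub_le_mul_add_of_tv` (run B's kernel fibrewise `σ`-close to run A's: TV_cl(`α·ρ + σ`)).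
* §2 CLASS LEVEL (coarse index `ι`, classes `T K`, bad classes `Bad K t`, pieces on `Ω₁ K`, kernels to `Ω₂ K`): `isFiniteMeasure_compPiece` · ★ `massSandwich_comp` (MASS_cl VERBATIM) ·
  `mass_zero_iff_of_sandwich` · ★★ `tvSandwich_comp_contract` (TV_cl(`α K·ρ K + σ K`) on the good classes — dag-n19-c's `hTV` on the image datum) · ★★★
  `core_comp_of_mass_of_tv_contract` (`core_of_mass_of_tv` BY NAME on the image datum: width `r K + (e^{2l₀B} − 1)(α K·ρ K + σ K) ≤ vol·δ K` ⇒ `Core l₀ vol T Bad P Q δ`) · ★★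
  `coreEdge_comp_of_mass_of_tv_contract` (`Summable r`, `Summable (αρ + σ)`, `0 < vol` ⇒ `∃ δ, Core … δ ∧ Summable δ`) · ★★ `coreEdge_comp_of_geometric` (exactly common steps,
  `α K ≤ a^K`, `0 ≤ a < 1`, `ρ K ∈ [0, 1]`, `Summable r` ⇒ the N19′ shape).
* §3 BLOCKS (the honest limit as a theorem): ★ `rows_parallelComp_le` (independent blocks stepped by `κ₁ ∥ₖ κ₂`: row coefficient `1 − (1 − α₁)(1 − α₂)`, g4 file 1's product bound on
  the row pairs; sharp by g4 file 2's `tv_prod_sharp_toy`) · `rows_parallelComp_le_one_of_frozen` (a frozen block (`α₂ = 1`) kills the pair's contraction) — over `N` blocks the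
  coefficient is `1 − (1 − α)^N → 1`: a PER-CLASS ∕ per-block tool, no volume-uniform contraction (TV analogue of g6-B4's additivity of projective diameters).
* §4 BRIDGE TO g6: ★ `rows_le_tanh_of_tilts` (rows that are mutual log-density tilts bounded by `δ` — projective diameter `Δ = 2δ` — are `tanh(δ∕2) = tanh(Δ∕4)`-close: dag-n14-w3's
  sharp constant BY NAME) · ★★ `abs_comp_real_sub_comp_real_le_tanh_mul_of_tv` (such a common step contracts the TV radius by `tanh(δ∕2)`): BIRKHOFF's coefficient DOMINATES
  DOBRUSHIN's — file 1 contracts at least as fast as g6's `classOsc_kernel_le_tanh_mul`, and also where the projective diameter is infinite.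

HONEST FRAMING.  [folklore] measure theory on hypothesis SHAPES produced by nobody: NO R ∕ T step of [Balaban1988Convergent] ∕ [Balaban1989LargeFieldI] ∕ [Balaban1989LargeFieldII]
is shown here or anywhere in the tree to act on the two runs' class pieces as a COMMON Markov kernel, let alone one with row coefficient `< 1` (the runs' steps are displayed as
`IsRT` ∕ integral-preserving maps on densities, `T4Continuum.Realisation`; g4's HANDOFF (t7) and the LENS control census INBOX l.16691 say the same); [III] (2.18)'s history
weights do NOT factor as such a step.  ZERO Bałaban content; NE7 ∕ NE1′ NOT PRINTED as two-run statements for d = 4 and NOT proved; N14 ∕ N19 NOT discharged; K3⁸ 27366 OPEN,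
not claimed; counts UNMOVED (typed 28∕28 · discharged 5∕27, A 5∕28); no count claim.  One finite four-torus programme at fixed `ε`; R4 closes the conditional finite-𝕋⁴ rung
`BalabanLadder.UV` only — NOT ℝ⁴, NOT OS, NOT the Yang–Mills mass gap, NOT Clay.  0 `def`; 0 `sorry`; standard axioms.
-/

set_option autoImplicit false

noncomputable section

open MeasureTheory ProbabilityTheory
open scoped ENNReal

namespace Summit.QuantumFields.YangMills.BalabanUVNodes.N19TVCommonStepContractionClasses

open Summit.QuantumFields.YangMills.BalabanUVNodes.N19TVProductBlocks
open Summit.QuantumFields.YangMills.BalabanUVNodes.N19TVCommonStepContraction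
open Summit.QuantumFields.BalabanUV.T4Continuum.NE1p.DressedMGFForm (MGFForm TiltedMeanMatching)
open Summit.QuantumFields.BalabanUV.T4Continuum.Spine.NE7 (Core)
open Summit.QuantumFields.YangMills.BalabanUVNodes.N19CoreTVInvariant (core_of_mass_of_tv)
open Summit.QuantumFields.YangMills.BalabanUVNodes.N19TVTiltSharpLeaf (tiltedMeanMatching_of_tv_half)

/-! ## §1 One class PIECE (a finite measure) through a common Markov step, in the normalised letters [folklore] -/

section OnePiece

variable {X Y : Type*} [MeasurableSpace X] [MeasurableSpace Y]

/-- **NORMALISATION COMMUTES WITH A MARKOV STEP**: `κ ∘ₘ (m⁻¹ • μ) = m⁻¹ • (κ ∘ₘ μ)` with `m = μ(univ) = (κ ∘ₘ μ)(univ)` (Mathlib `Measure.comp_smul`, `Measure.comp_apply_univ`).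
[folklore] -/
theorem normalized_comp (μ : Measure X) [IsFiniteMeasure μ] (κ : Kernel X Y) [IsMarkovKernel κ] :
    κ ∘ₘ ((μ Set.univ)⁻¹ • μ) = ((κ ∘ₘ μ) Set.univ)⁻¹ • (κ ∘ₘ μ) := by
  rw [Measure.comp_smul, Measure.comp_apply_univ]

/-- The normalised letters of the image piece ARE the real letters of the image of the normalised piece. [folklore] -/
theorem comp_div_eq_normalized_comp_real (μ : Measure X) [IsFiniteMeasure μ] (κ : Kernel X Y) [IsMarkovKernel κ] (S : Set Y) :
    (κ ∘ₘ μ).real S / (κ ∘ₘ μ).real Set.univ = (κ ∘ₘ ((μ Set.univ)⁻¹ • μ)).real S := by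
  rw [normalized_comp, normalized_real]

/-- ★★ **TV_cl OF CLASS PIECES THROUGH ONE COMMON CONTRACTING STEP.**  Two finite pieces `μ, μ′` that are massless together (`μ(univ) = 0 ↔ μ′(univ) = 0` — forced by any MASS_cl
sandwich), TV_cl(`ρ`) in dag-n19-c's normalised letters, pushed through ONE Markov kernel `κ` whose rows are pairwise `α`-close on every set (`0 ≤ α`) ⇒ the image pieces
`κ ∘ₘ μ`, `κ ∘ₘ μ′` are TV_cl(`α·ρ`): normalise (`normalized_comp`) and apply file 1's `abs_comp_real_sub_comp_real_le_mul_of_tv`. [folklore] -/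
theorem abs_comp_div_sub_le_mul_of_tv {μ μ' : Measure X} [IsFiniteMeasure μ] [IsFiniteMeasure μ'] (κ : Kernel X Y) [IsMarkovKernel κ] {α ρ : ℝ} (hα0 : 0 ≤ α)
    (hα : ∀ x y, ∀ S : Set Y, MeasurableSet S → |(κ x).real S - (κ y).real S| ≤ α)
    (hmass : μ Set.univ = 0 ↔ μ' Set.univ = 0)
    (h₁ : ∀ S : Set X, MeasurableSet S → |μ'.real S / μ'.real Set.univ - μ.real S / μ.real Set.univ| ≤ ρ) {S : Set Y} (hS : MeasurableSet S) :
    |(κ ∘ₘ μ').real S / (κ ∘ₘ μ').real Set.univ - (κ ∘ₘ μ).real S / (κ ∘ₘ μ).real Set.univ| ≤ α * ρ := by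
  have hρ : 0 ≤ ρ := (abs_nonneg _).trans (h₁ ∅ MeasurableSet.empty)
  by_cases hA : μ Set.univ = 0
  · have hB : μ' Set.univ = 0 := hmass.1 hA
    rw [div_univ_eq_zero_of_mass _ (by rw [Measure.comp_apply_univ]; exact hB),
      div_univ_eq_zero_of_mass _ (by rw [Measure.comp_apply_univ]; exact hA), sub_zero, abs_zero]
    exact mul_nonneg hα0 hρ
  have hB : μ' Set.univ ≠ 0 := fun h => hA (hmass.2 h)
  haveI := isProbabilityMeasure_normalized hA; haveI := isProbabilityMeasure_normalized hB
  have h₁' : ∀ S : Set X, MeasurableSet S → |((μ' Set.univ)⁻¹ • μ').real S - ((μ Set.univ)⁻¹ • μ).real S| ≤ ρ := fun S hS => by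
    rw [normalized_real, normalized_real]; exact h₁ S hS
  rw [comp_div_eq_normalized_comp_real μ' κ, comp_div_eq_normalized_comp_real μ κ]
  exact abs_comp_real_sub_comp_real_le_mul_of_tv hα h₁' hS

/-- ★ **… PLUS A FIBRE INJECTION**: run A's step `κ` (rows `α`-close, `0 ≤ α`), run B's step `κ′` fibrewise `σ`-close to `κ` on every set (`0 ≤ σ`) ⇒ the image pieces `κ ∘ₘ μ`, `κ′ ∘ₘ μ′`
are TV_cl(`α·ρ + σ`) (file 1's `abs_comp_real_sub_comp_real_le_mul_add_of_tv` on the normalised pieces; massless corner: both image pieces massless). [folklore] -/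
theorem abs_comp_div_sub_le_mul_add_of_tv {μ μ' : Measure X} [IsFiniteMeasure μ] [IsFiniteMeasure μ'] (κ κ' : Kernel X Y) [IsMarkovKernel κ] [IsMarkovKernel κ']
    {α ρ σ : ℝ} (hα0 : 0 ≤ α) (hσ0 : 0 ≤ σ)
    (hα : ∀ x y, ∀ S : Set Y, MeasurableSet S → |(κ x).real S - (κ y).real S| ≤ α)
    (hσ : ∀ x, ∀ S : Set Y, MeasurableSet S → |(κ' x).real S - (κ x).real S| ≤ σ)
    (hmass : μ Set.univ = 0 ↔ μ' Set.univ = 0)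
    (h₁ : ∀ S : Set X, MeasurableSet S → |μ'.real S / μ'.real Set.univ - μ.real S / μ.real Set.univ| ≤ ρ) {S : Set Y} (hS : MeasurableSet S) :
    |(κ' ∘ₘ μ').real S / (κ' ∘ₘ μ').real Set.univ - (κ ∘ₘ μ).real S / (κ ∘ₘ μ).real Set.univ| ≤ α * ρ + σ := by
  have hρ : 0 ≤ ρ := (abs_nonneg _).trans (h₁ ∅ MeasurableSet.empty)
  by_cases hA : μ Set.univ = 0
  · have hB : μ' Set.univ = 0 := hmass.1 hA
    rw [div_univ_eq_zero_of_mass _ (by rw [Measure.comp_apply_univ]; exact hB),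
      div_univ_eq_zero_of_mass _ (by rw [Measure.comp_apply_univ]; exact hA), sub_zero, abs_zero]
    positivity
  have hB : μ' Set.univ ≠ 0 := fun h => hA (hmass.2 h)
  haveI := isProbabilityMeasure_normalized hA; haveI := isProbabilityMeasure_normalized hB
  have h₁' : ∀ S : Set X, MeasurableSet S → |((μ' Set.univ)⁻¹ • μ').real S - ((μ Set.univ)⁻¹ • μ).real S| ≤ ρ := fun S hS => by
    rw [normalized_real, normalized_real]; exact h₁ S hS
  rw [comp_div_eq_normalized_comp_real μ' κ', comp_div_eq_normalized_comp_real μ κ]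
  exact abs_comp_real_sub_comp_real_le_mul_add_of_tv hα h₁' hσ hS

end OnePiece

/-! ## §2 Class level: the image datum `κ K τ ∘ₘ μX K τ` on the coarse datum's index [folklore] -/

section Classes

variable {ι : Type*} [DecidableEq ι] {Ω₁ Ω₂ : ℕ → Type*} [∀ K, MeasurableSpace (Ω₁ K)] [∀ K, MeasurableSpace (Ω₂ K)]
  {l₀ vol B : ℝ} {T : ℕ → Finset ι} {Bad : ℕ → ℝ → Finset ι}
  {μA μB : ∀ K, ι → Measure (Ω₁ K)} {κ κB : ∀ K, ι → Kernel (Ω₁ K) (Ω₂ K)} [∀ K τ, IsMarkovKernel (κ K τ)] [∀ K τ, IsMarkovKernel (κB K τ)]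
  {r α ρ σ δ : ℕ → ℝ} {W : ∀ K, Ω₂ K → ℝ} {P Q : ℕ → ℝ → ι → ℝ}

omit [DecidableEq ι] in
/-- The image class pieces are finite on the classes. [folklore] -/
theorem isFiniteMeasure_compPiece (hfin : ∀ K, ∀ τ ∈ T K, IsFiniteMeasure (μA K τ)) :
    ∀ K, ∀ τ ∈ T K, IsFiniteMeasure (κ K τ ∘ₘ μA K τ) := fun K τ hτ => by
  haveI := hfin K τ hτ
  infer_instance

/-- ★ **A MARKOV STEP CARRIES THE MASS_cl LETTER VERBATIM** (same constants, same radius — `Measure.comp_apply_univ`): dag-n19-c's `core_of_mass_of_tv` hypothesis `hM` on the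
image datum, whatever the (Markov) kernels of the two runs. [folklore] -/
theorem massSandwich_comp
    (hM : ∀ K : ℕ, ∃ c : ℝ, ∀ t : ℝ, |t| ≤ l₀ → ∀ τ ∈ T K \ Bad K t,
      ENNReal.ofReal (Real.exp (c - r K)) * μA K τ Set.univ ≤ μB K τ Set.univ ∧
        μB K τ Set.univ ≤ ENNReal.ofReal (Real.exp (c + r K)) * μA K τ Set.univ) :
    ∀ K : ℕ, ∃ c : ℝ, ∀ t : ℝ, |t| ≤ l₀ → ∀ τ ∈ T K \ Bad K t,
      ENNReal.ofReal (Real.exp (c - r K)) * (κ K τ ∘ₘ μA K τ) Set.univ ≤ (κB K τ ∘ₘ μB K τ) Set.univ ∧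
        (κB K τ ∘ₘ μB K τ) Set.univ ≤ ENNReal.ofReal (Real.exp (c + r K)) * (κ K τ ∘ₘ μA K τ) Set.univ := by
  intro K
  obtain ⟨c, hc⟩ := hM K
  refine ⟨c, fun t ht τ hτ => ?_⟩
  rw [Measure.comp_apply_univ, Measure.comp_apply_univ]
  exact hc t ht τ hτ

omit [DecidableEq ι] in
/-- A MASS_cl sandwich makes the two runs' pieces massless together. [folklore] -/
theorem mass_zero_iff_of_sandwich {K : ℕ} {τ : ι} {c rK : ℝ}
    (h : ENNReal.ofReal (Real.exp (c - rK)) * μA K τ Set.univ ≤ μB K τ Set.univ ∧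
      μB K τ Set.univ ≤ ENNReal.ofReal (Real.exp (c + rK)) * μA K τ Set.univ) :
    μA K τ Set.univ = 0 ↔ μB K τ Set.univ = 0 := by
  constructor
  · intro hA
    have := h.2
    rw [hA, mul_zero] at this
    exact le_antisymm this bot_le
  · intro hB
    have h1 := h.1
    rw [hB] at h1
    have h2 : ENNReal.ofReal (Real.exp (c - rK)) * μA K τ Set.univ = 0 := le_antisymm h1 bot_le
    rcases mul_eq_zero.1 h2 with h3 | h3
    · exact absurd h3 (by rw [ENNReal.ofReal_eq_zero, not_le]; exact Real.exp_pos _)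
    · exact h3

/-- ★★ **TV_cl OF THE IMAGE CLASS PIECES UNDER COMMON CONTRACTING STEPS WITH INJECTIONS.**  Coarse pieces MASS_cl (any radius; used only to pair the massless classes) and
TV_cl(`ρ K`) on the good classes; per `K` and class, run A's Markov step `κ K τ` has rows `α K`-close (`0 ≤ α K`) and run B's step `κB K τ` is fibrewise `σ K`-close to it
(`0 ≤ σ K`) ⇒ the image pieces are TV_cl(`α K·ρ K + σ K`) — dag-n19-c's `core_of_mass_of_tv` hypothesis `hTV` on the image datum.  Exactly common steps: `σ = 0`, radius
`α K·ρ K`. [folklore] -/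
theorem tvSandwich_comp_contract (hfinA : ∀ K, ∀ τ ∈ T K, IsFiniteMeasure (μA K τ)) (hfinB : ∀ K, ∀ τ ∈ T K, IsFiniteMeasure (μB K τ))
    (hM : ∀ K : ℕ, ∃ c : ℝ, ∀ t : ℝ, |t| ≤ l₀ → ∀ τ ∈ T K \ Bad K t,
      ENNReal.ofReal (Real.exp (c - r K)) * μA K τ Set.univ ≤ μB K τ Set.univ ∧
        μB K τ Set.univ ≤ ENNReal.ofReal (Real.exp (c + r K)) * μA K τ Set.univ)
    (hTV : ∀ (K : ℕ) (t : ℝ), |t| ≤ l₀ → ∀ τ ∈ T K \ Bad K t, ∀ S : Set (Ω₁ K), MeasurableSet S →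
      |(μB K τ).real S / (μB K τ).real Set.univ - (μA K τ).real S / (μA K τ).real Set.univ| ≤ ρ K)
    (hα0 : ∀ K, 0 ≤ α K) (hσ0 : ∀ K, 0 ≤ σ K)
    (hα : ∀ K, ∀ τ ∈ T K, ∀ x y, ∀ S : Set (Ω₂ K), MeasurableSet S → |(κ K τ x).real S - (κ K τ y).real S| ≤ α K)
    (hσ : ∀ K, ∀ τ ∈ T K, ∀ x, ∀ S : Set (Ω₂ K), MeasurableSet S → |(κB K τ x).real S - (κ K τ x).real S| ≤ σ K) :
    ∀ (K : ℕ) (t : ℝ), |t| ≤ l₀ → ∀ τ ∈ T K \ Bad K t, ∀ S : Set (Ω₂ K), MeasurableSet S →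
      |(κB K τ ∘ₘ μB K τ).real S / (κB K τ ∘ₘ μB K τ).real Set.univ -
          (κ K τ ∘ₘ μA K τ).real S / (κ K τ ∘ₘ μA K τ).real Set.univ| ≤ α K * ρ K + σ K := by
  intro K t ht τ hτ S hS
  have hτT : τ ∈ T K := (Finset.mem_sdiff.1 hτ).1
  haveI := hfinA K τ hτT; haveI := hfinB K τ hτT
  obtain ⟨c, hc⟩ := hM K
  exact abs_comp_div_sub_le_mul_add_of_tv (κ K τ) (κB K τ) (hα0 K) (hσ0 K) (hα K τ hτT) (hσ K τ hτT)
    (mass_zero_iff_of_sandwich (hc t ht τ hτ)) (hTV K t ht τ hτ) hS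

/-- ★★★ **`Spine.NE7.Core` FOR THE IMAGE DATUM, WITH THE CONTRACTED RADIUS.**  dag-n19-c's `core_of_mass_of_tv` BY NAME on the image class pieces `κ K τ ∘ₘ μA K τ`,
`κB K τ ∘ₘ μB K τ` (dressed image class terms `P, Q` in MGF form for one observable family `W K` on the image spaces, `|W| ≤ B`): coarse MASS_cl(`r K`) ∧ TV_cl(`ρ K`), common
steps with row coefficient `α K`, injections `σ K`, and the width bookkeeping `r K + (e^{2 l₀ B} − 1)·(α K·ρ K + σ K) ≤ vol·δ K` ⇒ `Core l₀ vol T Bad P Q δ`.  The TV half of the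
width is MULTIPLIED by the step's row coefficient — the class-level face of file 1 §1; the MASS half is untouched (g6-S2's «source floor» has no analogue to pay here: the
TV letter is per `K`, not per source value). [folklore] -/
theorem core_comp_of_mass_of_tv_contract (hP : MGFForm B T W (fun K τ => κ K τ ∘ₘ μA K τ) P) (hQ : MGFForm B T W (fun K τ => κB K τ ∘ₘ μB K τ) Q)
    (hfinA : ∀ K, ∀ τ ∈ T K, IsFiniteMeasure (μA K τ)) (hfinB : ∀ K, ∀ τ ∈ T K, IsFiniteMeasure (μB K τ))
    (hM : ∀ K : ℕ, ∃ c : ℝ, ∀ t : ℝ, |t| ≤ l₀ → ∀ τ ∈ T K \ Bad K t,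
      ENNReal.ofReal (Real.exp (c - r K)) * μA K τ Set.univ ≤ μB K τ Set.univ ∧
        μB K τ Set.univ ≤ ENNReal.ofReal (Real.exp (c + r K)) * μA K τ Set.univ)
    (hTV : ∀ (K : ℕ) (t : ℝ), |t| ≤ l₀ → ∀ τ ∈ T K \ Bad K t, ∀ S : Set (Ω₁ K), MeasurableSet S →
      |(μB K τ).real S / (μB K τ).real Set.univ - (μA K τ).real S / (μA K τ).real Set.univ| ≤ ρ K)
    (hα0 : ∀ K, 0 ≤ α K) (hσ0 : ∀ K, 0 ≤ σ K)
    (hα : ∀ K, ∀ τ ∈ T K, ∀ x y, ∀ S : Set (Ω₂ K), MeasurableSet S → |(κ K τ x).real S - (κ K τ y).real S| ≤ α K)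
    (hσ : ∀ K, ∀ τ ∈ T K, ∀ x, ∀ S : Set (Ω₂ K), MeasurableSet S → |(κB K τ x).real S - (κ K τ x).real S| ≤ σ K)
    (hw : ∀ K, r K + (Real.exp (2 * (l₀ * B)) - 1) * (α K * ρ K + σ K) ≤ vol * δ K) :
    Core l₀ vol T Bad P Q δ :=
  core_of_mass_of_tv hP hQ (massSandwich_comp hM) (tvSandwich_comp_contract hfinA hfinB hM hTV hα0 hσ0 hα hσ) hw

/-- ★★ **THE N19′ SHAPE FROM A CONTRACTED BIRTH.**  As above with the widths SUMMABLE: `Summable r` and `Summable (fun K ↦ α K·ρ K + σ K)` (e.g. `α K ≤ a^K` = the row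
coefficient of a composite of `K` common steps by file 1 §3, `ρ K ≤ 1`, `σ = 0`: next corollary), `0 < vol` ⇒ `∃ δ, Core l₀ vol T Bad P Q δ ∧ Summable δ`. [folklore] -/
theorem coreEdge_comp_of_mass_of_tv_contract (hP : MGFForm B T W (fun K τ => κ K τ ∘ₘ μA K τ) P) (hQ : MGFForm B T W (fun K τ => κB K τ ∘ₘ μB K τ) Q)
    (hfinA : ∀ K, ∀ τ ∈ T K, IsFiniteMeasure (μA K τ)) (hfinB : ∀ K, ∀ τ ∈ T K, IsFiniteMeasure (μB K τ))
    (hM : ∀ K : ℕ, ∃ c : ℝ, ∀ t : ℝ, |t| ≤ l₀ → ∀ τ ∈ T K \ Bad K t,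
      ENNReal.ofReal (Real.exp (c - r K)) * μA K τ Set.univ ≤ μB K τ Set.univ ∧
        μB K τ Set.univ ≤ ENNReal.ofReal (Real.exp (c + r K)) * μA K τ Set.univ)
    (hTV : ∀ (K : ℕ) (t : ℝ), |t| ≤ l₀ → ∀ τ ∈ T K \ Bad K t, ∀ S : Set (Ω₁ K), MeasurableSet S →
      |(μB K τ).real S / (μB K τ).real Set.univ - (μA K τ).real S / (μA K τ).real Set.univ| ≤ ρ K)
    (hα0 : ∀ K, 0 ≤ α K) (hσ0 : ∀ K, 0 ≤ σ K)
    (hα : ∀ K, ∀ τ ∈ T K, ∀ x y, ∀ S : Set (Ω₂ K), MeasurableSet S → |(κ K τ x).real S - (κ K τ y).real S| ≤ α K)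
    (hσ : ∀ K, ∀ τ ∈ T K, ∀ x, ∀ S : Set (Ω₂ K), MeasurableSet S → |(κB K τ x).real S - (κ K τ x).real S| ≤ σ K)
    (hvol : 0 < vol) (hr : Summable r) (hs : Summable fun K => α K * ρ K + σ K) :
    ∃ δ : ℕ → ℝ, Core l₀ vol T Bad P Q δ ∧ Summable δ := by
  set L : ℝ := Real.exp (2 * (l₀ * B)) - 1 with hL
  have hB : 0 ≤ B := hP.nonneg
  refine ⟨fun K => (r K + L * (α K * ρ K + σ K)) / vol, ?_, ?_⟩
  · refine core_comp_of_mass_of_tv_contract hP hQ hfinA hfinB hM hTV hα0 hσ0 hα hσ fun K => le_of_eq ?_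
    rw [hL]; field_simp
  · exact (hr.add (hs.mul_left L)).div_const vol

/-- ★★ **GEOMETRIC EDITION**: exactly common steps (`κB = κ`, so `σ = 0`) whose row coefficient at run pair `K` is `≤ a^K` (`0 ≤ a < 1`; by file 1 §3 the composite of `K`
common steps each with coefficient `≤ a`), a coarse TV_cl radius bounded by `1` (always available: `abs_real_sub_real_le_one` on the normalised laws), coarse MASS_cl with a summable
radius, `0 < vol` ⇒ the N19′ shape `∃ δ, Core … δ ∧ Summable δ` for the image datum — an `O(1)` class-law discrepancy at birth is FORGOTTEN summably through `K` common contracting steps.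
The TV twin of g6-S §4 `coreEdge_of_totals_of_commonSteps`. [folklore] -/
theorem coreEdge_comp_of_geometric {a : ℝ} (hP : MGFForm B T W (fun K τ => κ K τ ∘ₘ μA K τ) P) (hQ : MGFForm B T W (fun K τ => κ K τ ∘ₘ μB K τ) Q)
    (hfinA : ∀ K, ∀ τ ∈ T K, IsFiniteMeasure (μA K τ)) (hfinB : ∀ K, ∀ τ ∈ T K, IsFiniteMeasure (μB K τ))
    (hM : ∀ K : ℕ, ∃ c : ℝ, ∀ t : ℝ, |t| ≤ l₀ → ∀ τ ∈ T K \ Bad K t,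
      ENNReal.ofReal (Real.exp (c - r K)) * μA K τ Set.univ ≤ μB K τ Set.univ ∧
        μB K τ Set.univ ≤ ENNReal.ofReal (Real.exp (c + r K)) * μA K τ Set.univ)
    (hTV : ∀ (K : ℕ) (t : ℝ), |t| ≤ l₀ → ∀ τ ∈ T K \ Bad K t, ∀ S : Set (Ω₁ K), MeasurableSet S →
      |(μB K τ).real S / (μB K τ).real Set.univ - (μA K τ).real S / (μA K τ).real Set.univ| ≤ ρ K)
    (hρ0 : ∀ K, 0 ≤ ρ K) (hρ1 : ∀ K, ρ K ≤ 1) (ha0 : 0 ≤ a) (ha1 : a < 1) (hα0 : ∀ K, 0 ≤ α K) (hαa : ∀ K, α K ≤ a ^ K)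
    (hα : ∀ K, ∀ τ ∈ T K, ∀ x y, ∀ S : Set (Ω₂ K), MeasurableSet S → |(κ K τ x).real S - (κ K τ y).real S| ≤ α K)
    (hvol : 0 < vol) (hr : Summable r) :
    ∃ δ : ℕ → ℝ, Core l₀ vol T Bad P Q δ ∧ Summable δ := by
  refine coreEdge_comp_of_mass_of_tv_contract (κB := κ) (σ := fun _ => 0) hP hQ hfinA hfinB hM hTV hα0 (fun _ => le_rfl) hα
    (fun K τ _ x S _ => by rw [sub_self, abs_zero]) hvol hr ?_
  refine Summable.of_nonneg_of_le (fun K => by simpa using mul_nonneg (hα0 K) (hρ0 K)) (fun K => ?_) (summable_geometric_of_lt_one ha0 ha1)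
  calc α K * ρ K + 0 = α K * ρ K := add_zero _
    _ ≤ a ^ K * 1 := mul_le_mul (hαa K) (hρ1 K) (hρ0 K) (pow_nonneg ha0 K)
    _ = a ^ K := mul_one _

end Classes

/-! ## §3 Independent blocks: row coefficients compose like bad weights (extensivity) [folklore] -/

section Blocks

variable {X₁ X₂ Y₁ Y₂ : Type*} [MeasurableSpace X₁] [MeasurableSpace X₂] [MeasurableSpace Y₁] [MeasurableSpace Y₂]

/-- ★ **THE ROW COEFFICIENT OF A PRODUCT STEP.**  Two independent blocks stepped by Markov kernels `κ₁`, `κ₂` with rows `α₁`-, `α₂`-close (`α₂ ∈ [0, 1]`): the rows of the product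
step `κ₁ ∥ₖ κ₂` (`(x₁, x₂) ↦ κ₁ x₁ ⊗ κ₂ x₂`, Mathlib `Kernel.parallelComp`) are `(α₁ + α₂ − α₁α₂) = 1 − (1 − α₁)(1 − α₂)`-close — g4 file 1's `abs_prod_real_sub_prod_real_le_of_tv` on the
row pairs; SHARP by g4 file 2's `tv_prod_sharp_toy` (two-point rows).  LOCATED READING (the honest limit of file 1, as a theorem): over `N` independent blocks each contracting by
`α < 1` the global coefficient is only `1 − (1 − α)^N → 1` — Dobrushin's contraction, like dag-n19-c's TV_cl itself, is a PER-CLASS ∕ per-block tool, not a volume-uniform one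
(the TV analogue of g6-B4's «projective diameters ADD over independent blocks»). [folklore] -/
theorem rows_parallelComp_le (κ₁ : Kernel X₁ Y₁) [IsMarkovKernel κ₁] (κ₂ : Kernel X₂ Y₂) [IsMarkovKernel κ₂] {α₁ α₂ : ℝ} (hα₂0 : 0 ≤ α₂) (hα₂1 : α₂ ≤ 1)
    (hα₁ : ∀ x y, ∀ S : Set Y₁, MeasurableSet S → |(κ₁ x).real S - (κ₁ y).real S| ≤ α₁)
    (hα₂ : ∀ x y, ∀ S : Set Y₂, MeasurableSet S → |(κ₂ x).real S - (κ₂ y).real S| ≤ α₂) (x y : X₁ × X₂) {S : Set (Y₁ × Y₂)}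
    (hS : MeasurableSet S) :
    |((κ₁ ∥ₖ κ₂) x).real S - ((κ₁ ∥ₖ κ₂) y).real S| ≤ α₁ + α₂ - α₁ * α₂ := by
  rw [Kernel.parallelComp_apply, Kernel.parallelComp_apply]
  exact abs_prod_real_sub_prod_real_le_of_tv (p := κ₁ y.1) (p' := κ₁ x.1) (q := κ₂ y.2) (q' := κ₂ x.2) hα₂0 hα₂1
    (fun S hS => hα₁ x.1 y.1 S hS) (fun S hS => hα₂ x.2 y.2 S hS) hS

/-- **A CONTRACTING BLOCK NEXT TO A FROZEN ONE DOES NOT CONTRACT THE PAIR**: with `α₂ = 1` (the second block's step arbitrary, e.g. finite range with disjoint rows) the product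
coefficient is `1` whatever `α₁` is — the arithmetic face of «no volume-uniform contraction». [folklore] -/
theorem rows_parallelComp_le_one_of_frozen (κ₁ : Kernel X₁ Y₁) [IsMarkovKernel κ₁] (κ₂ : Kernel X₂ Y₂) [IsMarkovKernel κ₂] {α₁ : ℝ}
    (hα₁ : ∀ x y, ∀ S : Set Y₁, MeasurableSet S → |(κ₁ x).real S - (κ₁ y).real S| ≤ α₁) (x y : X₁ × X₂) {S : Set (Y₁ × Y₂)}
    (hS : MeasurableSet S) :
    |((κ₁ ∥ₖ κ₂) x).real S - ((κ₁ ∥ₖ κ₂) y).real S| ≤ 1 := by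
  have h := rows_parallelComp_le κ₁ κ₂ (α₂ := 1) zero_le_one le_rfl hα₁ (fun x y S _ => rows_le_one κ₂ x y S) x y hS
  linarith

end Blocks

/-! ## §4 Bridge to g6: Birkhoff's coefficient dominates Dobrushin's [folklore] -/

section Birkhoff

variable {X Y : Type*} [MeasurableSpace X] [MeasurableSpace Y]

/-- ★ **ROWS THAT ARE MUTUAL BOUNDED TILTS ARE `tanh(δ∕2)`-CLOSE.**  If every two rows of the Markov kernel `κ` are log-density tilts of each other with a tilt bounded by `δ`
(`κ_y = (κ_x).tilted g`, `|g| ≤ δ` — g6's hypothesis «rows of cross-ratio (projective) diameter `Δ = 2δ`» in density letters), then the rows are `tanh(δ∕2) = tanh(Δ∕4)`-close on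
every measurable set — dag-n14-w3's SHARP tilt-defect constant `YMDAG.N14.SharpTilt.abs_measureReal_tilted_sub_le_tanh` BY NAME (attained on two-point rows, their
`sharp_two_point`).  So a common step's DOBRUSHIN coefficient never exceeds its BIRKHOFF coefficient `tanh(Δ∕4)` (g6-B1 `tanh_quarter_*`): whatever g6's `…N19CoreCommonStep`
contracts in the log-ratio currency, file 1 contracts at least as fast in the TV currency — and file 1 also covers steps of infinite projective diameter. [folklore] -/
theorem rows_le_tanh_of_tilts (κ : Kernel X Y) [IsMarkovKernel κ] {δ : ℝ}
    (h : ∀ x y, ∃ g : Y → ℝ, Measurable g ∧ (∀ z, |g z| ≤ δ) ∧ κ y = (κ x).tilted g) (x y : X) {S : Set Y} (hS : MeasurableSet S) :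
    |(κ x).real S - (κ y).real S| ≤ Real.tanh (δ / 2) := by
  obtain ⟨g, hgm, hgb, hy⟩ := h x y
  rw [hy, abs_sub_comm]
  exact YMDAG.N14.SharpTilt.abs_measureReal_tilted_sub_le_tanh hgm hgb hS

/-- ★★ **A COMMON STEP OF PROJECTIVE DIAMETER `2δ` CONTRACTS THE TV RADIUS BY `tanh(δ∕2)`**: file 1's `abs_comp_real_sub_comp_real_le_mul_of_tv` with the row coefficient of
`rows_le_tanh_of_tilts` — base laws `ρ₁`-close ⇒ images `tanh(δ∕2)·ρ₁`-close.  (The TV face of g6-S's `classOsc_kernel_le_tanh_mul`; the rates coincide, the currencies differ: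
g6 contracts the CLASS-OSCILLATION half of `Core` and leaves a source floor, this contracts the whole per-`K` TV_cl letter.) [folklore] -/
theorem abs_comp_real_sub_comp_real_le_tanh_mul_of_tv {p p' : Measure X} [IsProbabilityMeasure p] [IsProbabilityMeasure p'] (κ : Kernel X Y) [IsMarkovKernel κ]
    {δ ρ₁ : ℝ} (h : ∀ x y, ∃ g : Y → ℝ, Measurable g ∧ (∀ z, |g z| ≤ δ) ∧ κ y = (κ x).tilted g)
    (h₁ : ∀ S : Set X, MeasurableSet S → |p'.real S - p.real S| ≤ ρ₁) {S : Set Y} (hS : MeasurableSet S) :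
    |(κ ∘ₘ p').real S - (κ ∘ₘ p).real S| ≤ Real.tanh (δ / 2) * ρ₁ :=
  abs_comp_real_sub_comp_real_le_mul_of_tv (fun x y _ hT => rows_le_tanh_of_tilts κ h x y hT) h₁ hS

end Birkhoff

end Summit.QuantumFields.YangMills.BalabanUVNodes.N19TVCommonStepContractionClasses

end
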